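import Summits.QuantumFields.YangMills.Theorems.EquipartitionCriticalityEquipartitionPinsProbeTangentComb
import HarnessLib

/-!
# Stub `stub_combShift` of line `Sketch` (crux `stmt-QuantumFields-8760`)

Route `EquipartitionCriticality` of `YangMills`, crux item `stmt-QuantumFields-8760`
(`Summit.QuantumFields.YangMills.Theses.EquipartitionCriticality.EquipartitionPinsProbe`), line
`Sketch`, stub `stub_combShift` (TS0).

What is proved: the deterministic group algebra behind the one-link Haar shift in the comb
(complete axial) gauge on `ℤ⁴`. For an edge `e = (x, i)` and the comb transport `G_U` of
`…TangentDefs` (`combTransport`):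

* (sharp locality) the comb path from `0` to `y` reads the edge `e` iff `y ∈ shadow e`; hence
  `G_{U'}(y) = G_U(y)` for `U' = U` updated at `e` whenever `y ∉ shadow e` — in particular
  `G_{U'}(x) = G_U(x)` if `x_i ≥ 0` and `G_{U'}(x + e_i) = G_U(x + e_i)` if `x_i < 0`
  (parts 3, 4, no comb hypothesis);
* (left shift, `x_i ≥ 0`, comb edge) replacing `U_e` by `G_U(x)⁻¹ k G_U(x) U_e` multiplies `G_U(y)`
  on the left by `k` exactly for `y ∈ shadow e` (part 1);
* (right shift, `x_i < 0`, comb edge) replacing `U_e` by `U_e G_U(x+e_i)⁻¹ k⁻¹ G_U(x+e_i)`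
  multiplies `G_U(y)` on the left by `k` exactly for `y ∈ shadow e` (part 2).

Proof: a sharp version of `CombBasics.lineZ_congr` (a straight transport by `m` steps reads exactly
the edges `t ∈ [0, m)` resp. `[m, 0)`), the splitting `CombBasics.lineZ_add` of the `i`-th leg of
the comb path to `y` at the edge `e`, and four-fold product bookkeeping (`fin_cases` + `group`).
-/

noncomputable section

open Literature.Probability.LatticeModels Literature.MathematicalPhysics.QuantumLattice
open Literature.MathematicalPhysics.QuantumFieldTheory.AxialGauge (line_congr)

namespace Summit.QuantumFields.YangMills.Theorems.EquipartitionPinsProbe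

namespace TangentCombShift

open CombBasics

variable {d : ℕ} {G : Type} [Group G]

/-! ### Sharp locality of straight transports -/

/-- **Sharp locality of a straight transport**: `lineZ U k m y` reads exactly the edges
`(y + t e_k, k)` with `0 ≤ t < m` (if `m ≥ 0`) resp. `m ≤ t < 0` (if `m < 0`). -/
theorem lineZ_congr_sharp {U U' : LGConfig d G} (k : Fin d) (m : ℤ) (y : Site d)
    (h : ∀ t : ℤ, (0 ≤ t ∧ t < m) ∨ (m ≤ t ∧ t < 0) →
      U (y + Pi.single k t, k) = U' (y + Pi.single k t, k)) :
    lineZ U k m y = lineZ U' k m y := by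
  rcases m with n | n
  · have hn : (Int.ofNat n : ℤ) = (n : ℤ) := rfl
    rw [hn] at h ⊢
    rw [lineZ_ofNat, lineZ_ofNat]
    exact line_congr k n y fun t ht =>
      h t (Or.inl ⟨by positivity, by exact_mod_cast ht⟩)
  · rw [lineZ_negSucc, lineZ_negSucc]
    congr 1
    refine line_congr k (n + 1) _ fun t ht => ?_
    have e1 : y - Pi.single k ((n : ℤ) + 1) + Pi.single k (t : ℤ) =
        y + Pi.single k ((t : ℤ) - ((n : ℤ) + 1)) := by
      rw [sub_single, add_single_add_single]; congr 2
    rw [e1]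
    refine h _ (Or.inr ⟨?_, ?_⟩)
    · rw [Int.negSucc_eq]; linarith
    · have : (t : ℤ) < (n : ℤ) + 1 := by exact_mod_cast ht
      linarith

/-- Updating `U` at an edge not read by the straight transport does not change it. -/
theorem lineZ_update_of_not_read (U : LGConfig d G) (e : ZdEdge d) (g : G) (k : Fin d) (m : ℤ)
    (y : Site d)
    (h : ∀ t : ℤ, (0 ≤ t ∧ t < m) ∨ (m ≤ t ∧ t < 0) → (y + Pi.single k t, k) ≠ e) :
    lineZ (Function.update U e g) k m y = lineZ U k m y :=
  lineZ_congr_sharp k m y fun t ht => Function.update_of_ne (h t ht) _ _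

/-- Updating `U` at an edge of another direction does not change a straight transport. -/
theorem lineZ_update_of_ne (U : LGConfig d G) {e : ZdEdge d} (g : G) {k : Fin d} (hk : k ≠ e.2)
    (m : ℤ) (y : Site d) : lineZ (Function.update U e g) k m y = lineZ U k m y :=
  lineZ_update_of_not_read U e g k m y fun _ _ heq => hk (congrArg Prod.snd heq)

/-- One forward step: `lineZ U k 1 y = U(y, k)`. -/
theorem lineZ_one (U : LGConfig d G) (k : Fin d) (y : Site d) : lineZ U k 1 y = U (y, k) := by
  have h := lineZ_add_one U k 0 y
  simpa using h

/-- One backward step: `lineZ U k (-1) (y + e_k) = U(y, k)⁻¹`. -/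
theorem lineZ_neg_one (U : LGConfig d G) (k : Fin d) (y : Site d) :
    lineZ U k (-1) (y + Pi.single k 1) = (U (y, k))⁻¹ := by
  have h := lineZ_add_one U k (-1) (y + Pi.single k 1)
  rw [show (-1 : ℤ) + 1 = 0 from by norm_num, lineZ_zero, add_single_add_single,
    show (1 : ℤ) + -1 = 0 from by norm_num, Pi.single_zero, add_zero] at h
  exact eq_inv_of_mul_eq_one_left h.symm

/-! ### The shadow is the read-set of the comb transport -/

/-- If the `k`-th leg of the comb path to `y` reads the edge `e`, then `y ∈ shadow e`. -/
theorem mem_shadow_of_read (y : Site 4) (k : Fin 4) (t : ℤ)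
    (ht : (0 ≤ t ∧ t < y k) ∨ (y k ≤ t ∧ t < 0))
    {e : ZdEdge 4}
    (he : (truncSite k y + Pi.single k t, k) = e) : y ∈ shadow e := by
  subst he
  simp only [shadow, Set.mem_setOf_eq, Pi.add_apply, truncSite_apply, Pi.single_apply,
    lt_self_iff_false, if_false, if_true, zero_add]
  refine ⟨fun j hj => ?_, fun j hj => ?_, fun h0 => ?_, fun h0 => ?_⟩
  · rw [if_neg (not_lt.2 hj.le), if_neg (ne_of_gt hj), add_zero]
  · rw [if_pos hj, if_neg (ne_of_lt hj), add_zero]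
  · omega
  · omega

/-- **Sharp locality of the comb transport**: updating `U` at an edge `e` does not change
`G_U(y)` unless `y ∈ shadow e`. -/
theorem combTransport_update_of_not_mem_shadow (U : LGConfig 4 G)
    (e : ZdEdge 4) (g : G) {y : Site 4}
    (hy : y ∉ shadow e) : combTransport (Function.update U e g) y = combTransport U y := by
  have leg : ∀ k : Fin 4, lineZ (Function.update U e g) k (y k) (truncSite k y) =
      lineZ U k (y k) (truncSite k y) := fun k =>
    lineZ_update_of_not_read U e g k (y k) _ fun t ht heq => hy (mem_shadow_of_read y k t ht heq)
  rw [combTransport_def, combTransport_def, leg 0, leg 1, leg 2, leg 3]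

/-! ### Four-fold product bookkeeping -/

/-- Bookkeeping for a four-fold product `f 0 f 1 f 2 f 3` (the legs of `G_U(y)`) against a second
one `f'` (the legs of `G_{U'}(y)`) and a third one `m` (the legs of `P = G_U(x)`): if `f'` and `f`
agree off the `i`-th factor, `m` agrees with `f` below `i` and is trivial above `i`, and the
`i`-th factors are `f i = m i · u`, `f' i = m i · u'` with `P u' = c P u`, then
`f' 0 f' 1 f' 2 f' 3 = c · f 0 f 1 f 2 f 3`. -/
theorem prod_four_conj (f f' m : Fin 4 → G) (i : Fin 4) (P c u u' : G)
    (hlt : ∀ k : Fin 4, k < i → f' k = f k ∧ m k = f k)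
    (hgt : ∀ k : Fin 4, i < k → f' k = f k ∧ m k = 1)
    (hf : f i = m i * u) (hf' : f' i = m i * u')
    (hP : P = m 0 * m 1 * m 2 * m 3) (hu : P * u' = c * P * u) :
    f' 0 * f' 1 * f' 2 * f' 3 = c * (f 0 * f 1 * f 2 * f 3) := by
  have hu' : u' = P⁻¹ * (c * P * u) := eq_inv_mul_of_mul_eq hu
  subst hu' hP
  fin_cases i
  · obtain ⟨a1, b1⟩ := hgt 1 (by decide); obtain ⟨a2, b2⟩ := hgt 2 (by decide)
    obtain ⟨a3, b3⟩ := hgt 3 (by decide)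
    simp only [Fin.zero_eta] at hf hf'
    rw [hf', a1, a2, a3, hf, b1, b2, b3]; group
  · obtain ⟨a2, b2⟩ := hgt 2 (by decide); obtain ⟨a3, b3⟩ := hgt 3 (by decide)
    obtain ⟨a0, b0⟩ := hlt 0 (by decide)
    simp only [Fin.mk_one] at hf hf'
    rw [hf', a0, a2, a3, hf, b0, b2, b3]; group
  · obtain ⟨a3, b3⟩ := hgt 3 (by decide)
    obtain ⟨a0, b0⟩ := hlt 0 (by decide); obtain ⟨a1, b1⟩ := hlt 1 (by decide)
    simp only [Fin.reduceFinMk] at hf hf'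
    rw [hf', a0, a1, a3, hf, b0, b1, b3]; group
  · obtain ⟨a0, b0⟩ := hlt 0 (by decide); obtain ⟨a1, b1⟩ := hlt 1 (by decide)
    obtain ⟨a2, b2⟩ := hlt 2 (by decide)
    simp only [Fin.reduceFinMk] at hf hf'
    rw [hf', a0, a1, a2, hf, b0, b1, b2]; group

/-! ### The one-link shifts along a comb edge -/

/-- **Left shift along a forward comb edge.** For a comb edge `e = (x, i)` with `x_i ≥ 0` and
`y ∈ shadow e`, replacing `U_e` by `G_U(x)⁻¹ c G_U(x) U_e` turns `G_U(y)` into `c G_U(y)`. -/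
theorem combTransport_update_conj_of_nonneg (U : LGConfig 4 G) {x : Site 4} {i : Fin 4}
    (hc : ∀ j : Fin 4, i < j → x j = 0) (hxi : 0 ≤ x i) (c : G) {y : Site 4}
    (hy : y ∈ shadow (x, i)) :
    combTransport (Function.update U (x, i)
      ((combTransport U x)⁻¹ * c * combTransport U x * U (x, i))) y = c * combTransport U y := by
  obtain ⟨-, hlt, hge, -⟩ := hy
  have hyi : x i + 1 ≤ y i := hge hxi
  -- the common base point of the `i`-th legs of the comb paths to `x` and to `y`
  have hz : truncSite i y = truncSite i x := by
    ext j; simp only [truncSite_apply]; split_ifs with hj; exacts [hlt j hj, rfl]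
  set U' : LGConfig 4 G := Function.update U (x, i)
    ((combTransport U x)⁻¹ * c * combTransport U x * U (x, i)) with hU'
  -- splitting of the `i`-th leg of the comb path to `y` at the edge `(x, i)`
  have split : ∀ V : LGConfig 4 G, lineZ V i (y i) (truncSite i y) =
      lineZ V i (x i) (truncSite i x) *
        (lineZ V i 1 x * lineZ V i (y i - x i - 1) (x + Pi.single i 1)) := by
    intro V
    have e1 : y i = x i + (1 + (y i - x i - 1)) := by ring
    calc lineZ V i (y i) (truncSite i y)
          = lineZ V i (x i + (1 + (y i - x i - 1))) (truncSite i x) := by rw [← e1, hz]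
      _ = _ := by rw [lineZ_add, truncSite_add_single_self hc, lineZ_add V i 1 (y i - x i - 1)]
  -- the pieces before and after the edge are not affected by the update
  have hA : lineZ U' i (x i) (truncSite i x) = lineZ U i (x i) (truncSite i x) := by
    refine lineZ_update_of_not_read U _ _ i (x i) _ fun t ht heq => ?_
    have h1 := congrArg (fun p : ZdEdge 4 => p.1 i) heq
    simp only [Pi.add_apply, truncSite_apply, lt_self_iff_false, if_false, Pi.single_eq_same,
      zero_add] at h1
    omega
  have hR : lineZ U' i (y i - x i - 1) (x + Pi.single i 1) =
      lineZ U i (y i - x i - 1) (x + Pi.single i 1) := by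
    refine lineZ_update_of_not_read U _ _ i _ _ fun t ht heq => ?_
    have h1 := congrArg (fun p : ZdEdge 4 => p.1 i) heq
    simp only [Pi.add_apply, Pi.single_eq_same] at h1
    omega
  have he : U' (x, i) = (combTransport U x)⁻¹ * c * combTransport U x * U (x, i) := by
    rw [hU', Function.update_self]
  rw [combTransport_def, combTransport_def]
  refine prod_four_conj (fun k => lineZ U k (y k) (truncSite k y))
    (fun k => lineZ U' k (y k) (truncSite k y)) (fun k => lineZ U k (x k) (truncSite k x)) i
    (combTransport U x) c (U (x, i) * lineZ U i (y i - x i - 1) (x + Pi.single i 1))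
    ((combTransport U x)⁻¹ * c * combTransport U x * U (x, i) *
      lineZ U i (y i - x i - 1) (x + Pi.single i 1))
    (fun k hk => ⟨lineZ_update_of_ne U _ (ne_of_lt hk) _ _, ?_⟩)
    (fun k hk => ⟨lineZ_update_of_ne U _ (ne_of_gt hk) _ _, ?_⟩) ?_ ?_
    (combTransport_def U x) ?_
  · -- legs below `i` of the comb paths to `x` and `y` coincide
    have hk' : truncSite k x = truncSite k y := by
      ext j; simp only [truncSite_apply]; split_ifs with hj
      exacts [(hlt j (hj.trans hk)).symm, rfl]
    show lineZ U k (x k) (truncSite k x) = lineZ U k (y k) (truncSite k y)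
    rw [hk', hlt k hk]
  · -- legs above `i` of the comb path to `x` are trivial
    show lineZ U k (x k) (truncSite k x) = 1
    rw [hc k hk, lineZ_zero]
  · show lineZ U i (y i) (truncSite i y) = lineZ U i (x i) (truncSite i x) * _
    rw [split U, lineZ_one]
  · show lineZ U' i (y i) (truncSite i y) = lineZ U i (x i) (truncSite i x) * _
    rw [split U', lineZ_one, hA, hR, he, mul_assoc]
  · group

/-- **Right shift along a backward comb edge.** For a comb edge `e = (x, i)` with `x_i < 0` and
`y ∈ shadow e`, replacing `U_e` by `U_e G_U(x + e_i)⁻¹ c⁻¹ G_U(x + e_i)` turns `G_U(y)` into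
`c G_U(y)`. -/
theorem combTransport_update_conj_of_neg (U : LGConfig 4 G) {x : Site 4} {i : Fin 4}
    (hc : ∀ j : Fin 4, i < j → x j = 0) (hxi : x i < 0) (c : G) {y : Site 4}
    (hy : y ∈ shadow (x, i)) :
    combTransport (Function.update U (x, i) (U (x, i) *
      ((combTransport U (x + Pi.single i 1))⁻¹ * c⁻¹ *
        combTransport U (x + Pi.single i 1)))) y = c * combTransport U y := by
  obtain ⟨-, hlt, -, hle⟩ := hy
  have hyi : y i ≤ x i := hle hxi
  have hc' : ∀ j : Fin 4, i < j → (x + Pi.single i 1 : Site 4) j = 0 := fun j hj => by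
    rw [Pi.add_apply, Pi.single_eq_of_ne (ne_of_gt hj), add_zero, hc j hj]
  have hz : truncSite i y = truncSite i x := by
    ext j; simp only [truncSite_apply]; split_ifs with hj; exacts [hlt j hj, rfl]
  have hz' : truncSite i (x + Pi.single i 1) = truncSite i x :=
    truncSite_add_single_of_le le_rfl x 1
  have hxpi : (x + Pi.single i 1 : Site 4) i = x i + 1 := by
    rw [Pi.add_apply, Pi.single_eq_same]
  set U' : LGConfig 4 G := Function.update U (x, i) (U (x, i) *
    ((combTransport U (x + Pi.single i 1))⁻¹ * c⁻¹ *
      combTransport U (x + Pi.single i 1))) with hU'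
  -- splitting of the `i`-th leg of the comb path to `y` at the edge `(x, i)`
  have split : ∀ V : LGConfig 4 G, lineZ V i (y i) (truncSite i y) =
      lineZ V i (x i + 1) (truncSite i x) *
        (lineZ V i (-1) (x + Pi.single i 1) * lineZ V i (y i - x i) x) := by
    intro V
    have e1 : y i = (x i + 1) + (-1 + (y i - x i)) := by ring
    calc lineZ V i (y i) (truncSite i y)
          = lineZ V i ((x i + 1) + (-1 + (y i - x i))) (truncSite i x) := by rw [← e1, hz]
      _ = _ := by
          rw [lineZ_add, ← add_single_add_single, truncSite_add_single_self hc,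
            lineZ_add V i (-1) (y i - x i), add_single_add_single,
            show (1 : ℤ) + -1 = 0 by norm_num, Pi.single_zero, add_zero]
  have hA : lineZ U' i (x i + 1) (truncSite i x) = lineZ U i (x i + 1) (truncSite i x) := by
    refine lineZ_update_of_not_read U _ _ i _ _ fun t ht heq => ?_
    have h1 := congrArg (fun p : ZdEdge 4 => p.1 i) heq
    simp only [Pi.add_apply, truncSite_apply, lt_self_iff_false, if_false, Pi.single_eq_same,
      zero_add] at h1
    omega
  have hR : lineZ U' i (y i - x i) x = lineZ U i (y i - x i) x := by
    refine lineZ_update_of_not_read U _ _ i _ _ fun t ht heq => ?_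
    have h1 := congrArg (fun p : ZdEdge 4 => p.1 i) heq
    simp only [Pi.add_apply, Pi.single_eq_same] at h1
    omega
  have he : U' (x, i) = U (x, i) * ((combTransport U (x + Pi.single i 1))⁻¹ * c⁻¹ *
      combTransport U (x + Pi.single i 1)) := by
    rw [hU', Function.update_self]
  rw [combTransport_def, combTransport_def]
  refine prod_four_conj (fun k => lineZ U k (y k) (truncSite k y))
    (fun k => lineZ U' k (y k) (truncSite k y))
    (fun k => lineZ U k ((x + Pi.single i 1 : Site 4) k) (truncSite k (x + Pi.single i 1))) i
    (combTransport U (x + Pi.single i 1)) c ((U (x, i))⁻¹ * lineZ U i (y i - x i) x)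
    ((U (x, i) * ((combTransport U (x + Pi.single i 1))⁻¹ * c⁻¹ *
        combTransport U (x + Pi.single i 1)))⁻¹ * lineZ U i (y i - x i) x)
    (fun k hk => ⟨lineZ_update_of_ne U _ (ne_of_lt hk) _ _, ?_⟩)
    (fun k hk => ⟨lineZ_update_of_ne U _ (ne_of_gt hk) _ _, ?_⟩) ?_ ?_
    (combTransport_def U (x + Pi.single i 1)) ?_
  · -- legs below `i` of the comb paths to `x + e_i` and `y` coincide
    have hk' : truncSite k x = truncSite k y := by
      ext j; simp only [truncSite_apply]; split_ifs with hj
      exacts [(hlt j (hj.trans hk)).symm, rfl]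
    show lineZ U k ((x + Pi.single i 1 : Site 4) k) (truncSite k (x + Pi.single i 1)) =
      lineZ U k (y k) (truncSite k y)
    rw [truncSite_add_single_of_le hk.le, Pi.add_apply, Pi.single_eq_of_ne (ne_of_lt hk),
      add_zero, hk', hlt k hk]
  · -- legs above `i` of the comb path to `x + e_i` are trivial
    show lineZ U k ((x + Pi.single i 1 : Site 4) k) (truncSite k (x + Pi.single i 1)) = 1
    rw [hc' k hk, lineZ_zero]
  · show lineZ U i (y i) (truncSite i y) =
      lineZ U i ((x + Pi.single i 1 : Site 4) i) (truncSite i (x + Pi.single i 1)) * _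
    rw [hxpi, hz', split U, lineZ_neg_one]
  · show lineZ U' i (y i) (truncSite i y) =
      lineZ U i ((x + Pi.single i 1 : Site 4) i) (truncSite i (x + Pi.single i 1)) * _
    rw [hxpi, hz', split U', lineZ_neg_one, hA, hR, he, mul_assoc]
  · group

end TangentCombShift

/-- STUB `stub_combShift` (TS0) of line `Sketch` (crux `stmt-QuantumFields-8760`) — **the
one-link shifts in the comb gauge.** For an edge `e = (x, i)` of `ℤ⁴`, a configuration `U` and
`k : G`: (1) if `e` is a comb edge with `x_i ≥ 0`, replacing `U_e` by `G_U(x)⁻¹ k G_U(x) U_e` turns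
the comb transport `G_U(y)` into `k G_U(y)` for `y ∈ shadow e` and leaves it unchanged otherwise;
(2) if `e` is a comb edge with `x_i < 0`, the same holds for the replacement of `U_e` by
`U_e G_U(x + e_i)⁻¹ k⁻¹ G_U(x + e_i)`; (3) if `x_i ≥ 0`, no update at `e` changes `G_U(x)`;
(4) if `x_i < 0`, no update at `e` changes `G_U(x + e_i)`. -/
theorem stub_combShift :
    ∀ (G : Type) [Group G] (U : Literature.MathematicalPhysics.QuantumLattice.LGConfig 4 G) (e : Literature.MathematicalPhysics.QuantumLattice.ZdEdge 4) (k : G),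
      ((∀ j : Fin 4, e.2 < j → e.1 j = 0) → 0 ≤ e.1 e.2 → ∀ y : Literature.Probability.LatticeModels.Site 4,
        Summit.QuantumFields.YangMills.Theorems.EquipartitionPinsProbe.combTransport (Function.update U e
            ((Summit.QuantumFields.YangMills.Theorems.EquipartitionPinsProbe.combTransport U e.1)⁻¹ * k * Summit.QuantumFields.YangMills.Theorems.EquipartitionPinsProbe.combTransport U e.1 * U e)) y =
          (if y ∈ Summit.QuantumFields.YangMills.Theorems.EquipartitionPinsProbe.shadow e then k else 1) * Summit.QuantumFields.YangMills.Theorems.EquipartitionPinsProbe.combTransport U y) ∧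
      ((∀ j : Fin 4, e.2 < j → e.1 j = 0) → e.1 e.2 < 0 → ∀ y : Literature.Probability.LatticeModels.Site 4,
        Summit.QuantumFields.YangMills.Theorems.EquipartitionPinsProbe.combTransport (Function.update U e
            (U e * ((Summit.QuantumFields.YangMills.Theorems.EquipartitionPinsProbe.combTransport U (e.1 + Pi.single e.2 1))⁻¹ * k⁻¹ *
              Summit.QuantumFields.YangMills.Theorems.EquipartitionPinsProbe.combTransport U (e.1 + Pi.single e.2 1)))) y =
          (if y ∈ Summit.QuantumFields.YangMills.Theorems.EquipartitionPinsProbe.shadow e then k else 1) * Summit.QuantumFields.YangMills.Theorems.EquipartitionPinsProbe.combTransport U y) ∧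
      (0 ≤ e.1 e.2 → ∀ g : G, Summit.QuantumFields.YangMills.Theorems.EquipartitionPinsProbe.combTransport (Function.update U e g) e.1 = Summit.QuantumFields.YangMills.Theorems.EquipartitionPinsProbe.combTransport U e.1) ∧
      (e.1 e.2 < 0 → ∀ g : G,
        Summit.QuantumFields.YangMills.Theorems.EquipartitionPinsProbe.combTransport (Function.update U e g) (e.1 + Pi.single e.2 1) =
          Summit.QuantumFields.YangMills.Theorems.EquipartitionPinsProbe.combTransport U (e.1 + Pi.single e.2 1)) := by
  intro G _ U e k
  obtain ⟨x, i⟩ := e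
  dsimp only
  refine ⟨fun hc hxi y => ?_, fun hc hxi y => ?_, fun hxi g => ?_, fun hxi g => ?_⟩
  · by_cases hy : y ∈ shadow (x, i)
    · rw [if_pos hy]; exact TangentCombShift.combTransport_update_conj_of_nonneg U hc hxi k hy
    · rw [if_neg hy, one_mul]
      exact TangentCombShift.combTransport_update_of_not_mem_shadow U _ _ hy
  · by_cases hy : y ∈ shadow (x, i)
    · rw [if_pos hy]; exact TangentCombShift.combTransport_update_conj_of_neg U hc hxi k hy
    · rw [if_neg hy, one_mul]
      exact TangentCombShift.combTransport_update_of_not_mem_shadow U _ _ hy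
  · refine TangentCombShift.combTransport_update_of_not_mem_shadow U _ g fun hx => ?_
    have h1 := hx.2.2.1 hxi
    dsimp only at h1
    omega
  · refine TangentCombShift.combTransport_update_of_not_mem_shadow U _ g fun hx => ?_
    have h1 := hx.2.2.2 hxi
    simp only [Pi.add_apply, Pi.single_eq_same] at h1
    omega

end Summit.QuantumFields.YangMills.Theorems.EquipartitionPinsProbe

end
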